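import Mathlib.Probability.Distributions.Gaussian.Multivariate
import Mathlib.Probability.Distributions.Gaussian.HasGaussianLaw.Basic
import Mathlib.Probability.Moments.SubGaussian
import Literature.Probability.Process.BrownianModulus
import HarnessLib

/-!
# Linear functionals of a multivariate Gaussian: sub-Gaussian tails and the maximum over a
# finite family (the "fluctuation-field regularity" input of multiscale expansions)

Topic `Probability/Distributions`, namespace `Literature.Probability.Distributions`.  For Mathlib's
centred multivariate Gaussian `N(0,S) = multivariateGaussian 0 S` on `ℝ^ι = EuclideanSpace ℝ ι`
(`S` positive semidefinite) and a vector `ℓ : ι → ℝ`, the functional `z ↦ ℓ·z` has the law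
`N(0, ℓᵀSℓ)` (`map_dotProduct_multivariateGaussian`), hence is sub-Gaussian with every constant
`v ≥ ℓᵀSℓ`, and

  `N(0,S){ℓ·z ≥ t} ≤ exp(−t²/(2v))`, `N(0,S){|ℓ·z| ≥ t} ≤ 2exp(−t²/(2v))`,
  `N(0,S){∃ α ∈ A, |ℓ_α·z| ≥ t} ≤ 2|A|·exp(−t²/(2v))`  (`v ≥ max_α ℓ_αᵀSℓ_α`, `v > 0`, `t ≥ 0`).

This is the elementary Gaussian concentration behind the small-field/large-field splitting of a
renormalisation-group step (the probability that some increment `ζ(x+e) − ζ(x)` of the scale-`j`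
fluctuation field in a block exceeds the threshold `p_j`: Bauerschmidt–Brydges–Slade 2019, §10.1;
Brydges–Slade 2015; in the large-field form, Balaban's and Dimock's "small field conditions"),
and equally the standard maximal inequality for finitely many Gaussians (Boucheron–Lugosi–Massart,
*Concentration Inequalities*, §2.5: `E max ≤ σ√(2 log N)`, of which the displayed union bound is the
tail form).  Everything is a direct assembly of Mathlib (`IsGaussian.map_eq_gaussianReal`,
`covarianceBilin_multivariateGaussian`, `mgf_gaussianReal`, `HasSubgaussianMGF.measure_ge_le`).

## Contents (no definition, no named fact)

* `HasSubgaussianMGF.mono_const` (the tree's `BrownianModulus.hasSubgaussianMGF_id_gaussianReal` is reused);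
* **`map_dotProduct_multivariateGaussian`** — the law `N(0, ℓᵀSℓ)` of `z ↦ Σ_i ℓ_i z_i`;
* `hasSubgaussianMGF_dotProduct`, **`measureReal_dotProduct_ge_le`**, `measureReal_abs_dotProduct_ge_le`,
  **`measureReal_exists_abs_dotProduct_ge_le`**.

## References

* S. Boucheron, G. Lugosi, P. Massart, *Concentration Inequalities* (OUP 2013), §2.3 (sub-Gaussian
  tails, Chernoff), §2.5 (maximal inequality). [BoucheronLugosiMassart2013]
* R. Bauerschmidt, D. C. Brydges, G. Slade, LNM 2242 (2019), §10.1. [BauerschmidtBrydgesSlade2019RG]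
-/

noncomputable section

open MeasureTheory ProbabilityTheory Real Finset
open scoped NNReal ENNReal InnerProductSpace Matrix

namespace Literature.Probability.Distributions

/-! ### Sub-Gaussianity of a real Gaussian -/

/-- A larger constant is still a sub-Gaussian constant. [folklore] -/
theorem HasSubgaussianMGF.mono_const {Ω : Type*} {mΩ : MeasurableSpace Ω} {μ : Measure Ω}
    {X : Ω → ℝ} {c c' : ℝ≥0} (h : HasSubgaussianMGF X c μ) (hc : c ≤ c') :
    HasSubgaussianMGF X c' μ where
  integrable_exp_mul := h.integrable_exp_mul
  mgf_le t := (h.mgf_le t).trans (by gcongr)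

/-! ### Linear functionals of `N(0,S)` -/

variable {ι : Type*} [Fintype ι] [DecidableEq ι]

omit [DecidableEq ι] in
/-- The functional `z ↦ Σ_i ℓ_i z_i` on `ℝ^ι` as an inner product with `toLp ℓ`. [folklore] -/
theorem dotProduct_eq_inner (ℓ : ι → ℝ) (z : EuclideanSpace ℝ ι) :
    (∑ i, ℓ i * z i) = ⟪(WithLp.toLp 2 ℓ : EuclideanSpace ℝ ι), z⟫_ℝ := by
  rw [PiLp.inner_apply]
  refine Finset.sum_congr rfl fun i _ => ?_
  simp [mul_comm]

/-- **The law of a linear functional of the centred multivariate Gaussian**: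
`(z ↦ ℓ·z)_* N(0,S) = N(0, ℓᵀSℓ)`. [folklore] -/
theorem map_dotProduct_multivariateGaussian {S : Matrix ι ι ℝ} (hS : S.PosSemidef) (ℓ : ι → ℝ) :
    (multivariateGaussian 0 S).map (fun z : EuclideanSpace ℝ ι => ∑ i, ℓ i * z i) =
      gaussianReal 0 (ℓ ⬝ᵥ S *ᵥ ℓ).toNNReal := by
  set P : Measure (EuclideanSpace ℝ ι) := multivariateGaussian 0 S with hP
  set a : EuclideanSpace ℝ ι := WithLp.toLp 2 ℓ with ha
  have hfun : (fun z : EuclideanSpace ℝ ι => ∑ i, ℓ i * z i) = fun z => ⟪a, z⟫_ℝ := by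
    funext z; exact dotProduct_eq_inner ℓ z
  rw [hfun]
  have hX : HasGaussianLaw (fun z : EuclideanSpace ℝ ι => ⟪a, z⟫_ℝ) P := by
    refine ⟨?_⟩
    have : (fun z : EuclideanSpace ℝ ι => ⟪a, z⟫_ℝ) = (innerSL ℝ a : EuclideanSpace ℝ ι → ℝ) := by
      funext z; rfl
    rw [this]
    infer_instance
  rw [hX.map_eq_gaussianReal]
  -- mean `0`
  have hmean : P[fun z : EuclideanSpace ℝ ι => ⟪a, z⟫_ℝ] = 0 := by
    have h := integral_inner (𝕜 := ℝ) (μ := P) (f := id)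
      (IsGaussian.memLp_two_id.integrable one_le_two) a
    simp only [id_eq] at h
    rw [h, integral_id_multivariateGaussian]
    simp
  -- variance `ℓᵀSℓ`
  have hvar : Var[fun z : EuclideanSpace ℝ ι => ⟪a, z⟫_ℝ; P] = ℓ ⬝ᵥ S *ᵥ ℓ := by
    rw [← covariance_self (by fun_prop), ← covarianceBilin_apply_eq_cov IsGaussian.memLp_two_id,
      covarianceBilin_multivariateGaussian hS]
  rw [hmean, hvar]

/-- The functional `z ↦ ℓ·z` is sub-Gaussian under `N(0,S)` with any constant `v ≥ ℓᵀSℓ`.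
[cite: BoucheronLugosiMassart2013, §2.3] -/
theorem hasSubgaussianMGF_dotProduct {S : Matrix ι ι ℝ} (hS : S.PosSemidef) (ℓ : ι → ℝ) {v : ℝ≥0}
    (hv : ℓ ⬝ᵥ S *ᵥ ℓ ≤ v) :
    HasSubgaussianMGF (fun z : EuclideanSpace ℝ ι => ∑ i, ℓ i * z i) v (multivariateGaussian 0 S) := by
  have hmeas : AEMeasurable (fun z : EuclideanSpace ℝ ι => ∑ i, ℓ i * z i) (multivariateGaussian 0 S) :=
    (Measurable.aemeasurable (by fun_prop))
  have h := (HasSubgaussianMGF.id_map_iff hmeas).mp (by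
    rw [map_dotProduct_multivariateGaussian hS ℓ]
    exact Literature.Probability.Process.BrownianModulus.hasSubgaussianMGF_id_gaussianReal _)
  refine HasSubgaussianMGF.mono_const h ?_
  rw [← NNReal.coe_le_coe, Real.coe_toNNReal']
  exact max_le hv v.2

/-- **One-sided tail**: `N(0,S){z : ℓ·z ≥ t} ≤ exp(−t²/(2v))` for `v ≥ ℓᵀSℓ`, `t ≥ 0`.
[cite: BoucheronLugosiMassart2013, §2.3 (Chernoff bound for sub-Gaussian variables)] -/
theorem measureReal_dotProduct_ge_le {S : Matrix ι ι ℝ} (hS : S.PosSemidef) (ℓ : ι → ℝ) {v : ℝ≥0}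
    (hv : ℓ ⬝ᵥ S *ᵥ ℓ ≤ v) {t : ℝ} (ht : 0 ≤ t) :
    (multivariateGaussian 0 S).real {z : EuclideanSpace ℝ ι | t ≤ ∑ i, ℓ i * z i} ≤
      Real.exp (-t ^ 2 / (2 * v)) :=
  (hasSubgaussianMGF_dotProduct hS ℓ hv).measure_ge_le ht

/-- **Two-sided tail**: `N(0,S){z : |ℓ·z| ≥ t} ≤ 2exp(−t²/(2v))`. [cite: BoucheronLugosiMassart2013, §2.3] -/
theorem measureReal_abs_dotProduct_ge_le {S : Matrix ι ι ℝ} (hS : S.PosSemidef) (ℓ : ι → ℝ)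
    {v : ℝ≥0} (hv : ℓ ⬝ᵥ S *ᵥ ℓ ≤ v) {t : ℝ} (ht : 0 ≤ t) :
    (multivariateGaussian 0 S).real {z : EuclideanSpace ℝ ι | t ≤ |∑ i, ℓ i * z i|} ≤
      2 * Real.exp (-t ^ 2 / (2 * v)) := by
  have hsub : {z : EuclideanSpace ℝ ι | t ≤ |∑ i, ℓ i * z i|} ⊆
      {z | t ≤ ∑ i, ℓ i * z i} ∪ {z | t ≤ ∑ i, (-ℓ) i * z i} := by
    intro z hz
    simp only [Set.mem_setOf_eq, Set.mem_union, Pi.neg_apply, neg_mul, Finset.sum_neg_distrib] at hz ⊢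
    rcases le_abs.mp hz with h | h
    · exact Or.inl h
    · exact Or.inr h
  have hneg : (-ℓ) ⬝ᵥ S *ᵥ (-ℓ) ≤ v := by rwa [neg_dotProduct, Matrix.mulVec_neg, dotProduct_neg, neg_neg]
  calc (multivariateGaussian 0 S).real {z : EuclideanSpace ℝ ι | t ≤ |∑ i, ℓ i * z i|}
      ≤ (multivariateGaussian 0 S).real ({z | t ≤ ∑ i, ℓ i * z i} ∪ {z | t ≤ ∑ i, (-ℓ) i * z i}) :=
        measureReal_mono hsub
    _ ≤ (multivariateGaussian 0 S).real {z | t ≤ ∑ i, ℓ i * z i} +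
          (multivariateGaussian 0 S).real {z | t ≤ ∑ i, (-ℓ) i * z i} := measureReal_union_le _ _
    _ ≤ Real.exp (-t ^ 2 / (2 * v)) + Real.exp (-t ^ 2 / (2 * v)) :=
        add_le_add (measureReal_dotProduct_ge_le hS ℓ hv ht) (measureReal_dotProduct_ge_le hS (-ℓ) hneg ht)
    _ = 2 * Real.exp (-t ^ 2 / (2 * v)) := by ring

/-- **The maximum over a finite family (union bound)**: for a finite family of vectors `ℓ_α`
with `ℓ_αᵀSℓ_α ≤ v` for all `α ∈ A`,
`N(0,S){z : ∃ α ∈ A, |ℓ_α·z| ≥ t} ≤ 2|A|·exp(−t²/(2v))`.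
[cite: BoucheronLugosiMassart2013, §2.5 (maximal inequality for finitely many sub-Gaussian variables)] -/
theorem measureReal_exists_abs_dotProduct_ge_le {S : Matrix ι ι ℝ} (hS : S.PosSemidef)
    {A : Type*} (s : Finset A) (ℓ : A → ι → ℝ) {v : ℝ≥0} (hv : ∀ α ∈ s, ℓ α ⬝ᵥ S *ᵥ ℓ α ≤ v)
    {t : ℝ} (ht : 0 ≤ t) :
    (multivariateGaussian 0 S).real {z : EuclideanSpace ℝ ι | ∃ α ∈ s, t ≤ |∑ i, ℓ α i * z i|} ≤
      2 * s.card * Real.exp (-t ^ 2 / (2 * v)) := by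
  have hset : {z : EuclideanSpace ℝ ι | ∃ α ∈ s, t ≤ |∑ i, ℓ α i * z i|} =
      ⋃ α ∈ s, {z | t ≤ |∑ i, ℓ α i * z i|} := by
    ext z; simp
  rw [hset]
  refine (measureReal_biUnion_finset_le s _).trans ?_
  calc ∑ α ∈ s, (multivariateGaussian 0 S).real {z : EuclideanSpace ℝ ι | t ≤ |∑ i, ℓ α i * z i|}
      ≤ ∑ α ∈ s, 2 * Real.exp (-t ^ 2 / (2 * v)) :=
        Finset.sum_le_sum fun α hα => measureReal_abs_dotProduct_ge_le hS (ℓ α) (hv α hα) ht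
    _ = 2 * s.card * Real.exp (-t ^ 2 / (2 * v)) := by
        rw [Finset.sum_const, nsmul_eq_mul]; ring

end Literature.Probability.Distributions

end
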